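import Literature.MathematicalPhysics.QuantumFieldTheory.Balaban1983to89.Beta.BalabanStepJetsSucc

/-!
# `BalabanUV.Beta.GAN24.E3UnitSplit` — binder row G-an2-4 / (CONV-C), S-slot, road «S3-fibre²»: THE (PC-1) UNIT SPLIT OF THE NORMALISED
# THIRD JET, KERNEL-CHECKED — part 1: the third-jet functional of a stencil family, its exact channel reductions, and THE SPLIT OF RECORD
# FOR THE WILSON CHANNEL `e3W_unit_split` (row owner gan24-p1 RULINGS-2: «(PC-1) SPLIT OF RECORD … to be kernel-checked by your engines»;
# engine of the idle leaf seat b2b-balaban-gan24-formalise-leaf-01-g10; part 2 = `GAN24/E3UnitSplitLevels`, the (V-H)/(Λ) templates per level)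

NOT IN PRINT; OUR PROOF ATTEMPT.  HONEST FRAMING (cell contract, verbatim): «discharging `BetaPertH` makes Bałaban's UV stability
UNCONDITIONAL — a real constructive-QFT result; it is NOT the continuum limit and NOT the Clay problem.»  HONEST DEPENDENCY (verbatim):
«continuum YM on T⁴ ⇐ BetaPertH ∧ nine spine estimates (0/9 proved); BetaPertH ⇐ (D1) ∧ (D4) ∧ CAP+tail; G-an2-4 gates asym, D1 and
NE2/3/4.»  [folklore] exponent bookkeeping over an2's DEFINITIONS (`BalabanStepJetsSucc.e3Of`/`mmRead`, `OneStepResolventKernel.KInv`/`vertexOf`,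
`BalabanCompositeJets.Sc`, `StepJetData.wilsonA` BY NAME): no estimate, no cited fact, no `Prop` mirror, ONE plumbing `def` (`e3OfS`, the
third-jet functional of an arbitrary stencil family); the only «analysis» is `tsum_mul_left` (unconditional over `ℝ`) — NO tsum is split or
reordered (the nesting of `e3Of`'s definition is kept literally; Fubini under the decay bounds is NOT used).  Discharges NOTHING of
«E3Shape»/«E3SupRate», (hS, hSall), the K-slot, BetaPertH; NOT continuum, NOT Clay.

## What is proved (generic `d`, any blocking `N ≥ 1`; member `n+1` of an2's family reads `Sc … n` at `N = Lc^{n+1}`, `e3Of_succ_eq_e3OfS`)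
§1 `e3OfS N S κ′ u′ := −mmRead N (KInv_N ∘ vertexOf_N S κ′ u′ ∘ KInv_N)` and the EXACT CHANNEL REDUCTIONS of its field–field block
   (`e3OfS_inl_inl` raw; `e3OfS_ff`: an ff-supported family is read by the legs `GamΦ_N` (row) and `wH_N` (column) ONLY — never `Γ`, never
   `wΦ`; `e3OfS_fm` / `e3OfS_mf` / `e3OfS_offdiag`: an off-diagonal family is read by (`(KInv_N)_{mm}`, `wH_N`) + (`GamΦ_N`, `(KInv_N)_{mm}`)
   INSIDE the outer tsum; `e3OfS_inl_inr` / `e3OfS_inr`: no multiplier legs) — leaf-18-g10's (PC-1) channel split as kernel identities.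
§2 scalar pull-through (`pull_inner`, `pull_legs`, `chan_pull`, `pull_two_inner`, `pull_two_legs`): leg units and stencil weights factor out
   of the (one- or two-channel) sandwich without touching the tsum nesting.
§3 **`e3W_unit_split`** — THE SPLIT OF RECORD, WILSON CHANNEL (the owner's shape verbatim; member `n+1`, `N = Lc^{n+1}`): with
   `H̃_N := N^{d+2}·wH_N`, `G̃_N := N^{d+2}·GamΦ_N`, the vertex-location sum as the block average `N^{−(d+1)}Σ'_u`, ONE explicit `N` on `wilsonA`
   and Sc's own factor `(Lc^{d+1})^n` (the Wilson part of `Sc … n` — `PushSumNest.Sc_succ_closed`, the push being the identity on it):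
   `N^{2(d+1)} · e3OfS N ((cE·(Lc^{d+1})^n) • wilsonA) = −(cE/Lc^{d+1}) · N^{d−3} · Σ'_y Σ_{l′} (Σ'_w Σ_l G̃ · Σ_{κ″} N^{−(d+1)}Σ'_u H̃ · (N·wilsonA)) · H̃`
   — RESIDUAL `N^{d−3}` (`e3W_residual`: the exponent identity `2(d+1) + (d+1)·n-part − 3(d+2) + (d+1) − 1 ↦ d − 3`), `= 1` EXACTLY at `d = 3`:
   the marginality of the cubic vertex in four dimensions as a kernel-checked EXPONENT IDENTITY (an identity between two rewritings of the
   same number — it asserts nothing about sizes; ref2 R29-1: the size reading stays design-grade until an engine witnesses it).  READING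
   (displayed, NOT claimed): «E3Shape» for this channel ⇔ the unit sandwich with `N·wilsonA` is `O(N^{3−d})` uniformly in the member —
   (PC-2)/(N1′): the one `N` is to be cashed against the table's lattice curl (leaf-18-g10 `sum_wilsonA_eq_zero`, probe).
-/

noncomputable section

open Finset
open scoped BigOperators
open Literature.MathematicalPhysics.QuantumFieldTheory
open Literature.MathematicalPhysics.QuantumFieldTheory.Balaban1983to89
open Literature.MathematicalPhysics.QuantumFieldTheory.Balaban1983to89.Beta
open ExpKernelCalculus (MKer comp)
open KernelSpecInstance (wH wΦ)
open KKTFluctuationKernel (Gam GamΦ)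
open OneStepResolventKernel (Fib LocStencil KInv wsum vertexOf KInv_inl_inr_coarse KInv_inr_inl_coarse KInv_inl_inl)
open StepJetData (wilsonA)
open BalabanCompositeJets (Sc)
open BalabanStepJetsSucc (e3Of mmRead)

namespace Summit.QuantumFields.BalabanUV.Beta.GAN24.E3UnitSplit

variable {d : ℕ}

/-! ## §1 The third-jet functional of a stencil family and its channels -/

/-- [folklore] **THE THIRD-JET FUNCTIONAL** of a stencil family `S` at one-shot blocking `N`:
`e3OfS N S κ′ u′ := −mmRead N (KInv_N ∘ vertexOf_N S κ′ u′ ∘ KInv_N)` — an2's `e3Of … n` is `e3OfS (Lc^n) (Sc … (n−1))` (`e3Of_eq_e3OfS`). -/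
def e3OfS (N : ℕ) [NeZero N] (S : Fin (d + 1) → (Fin (d + 1) → ℤ) → MKer (d + 1) (Fib d)) (κ' : Fin (d + 1))
    (u' : Fin (d + 1) → ℤ) : MKer (d + 1) (Fib d) :=
  fun x' z' a b => -(mmRead N (comp (comp (KInv (N := N) (d := d)) (vertexOf (N := N) S κ' u')) (KInv (N := N) (d := d))) x' z' a b)

/-- [folklore] an2's `e3Of … n` is the third-jet functional of the level-`(n−1)` composite stencil family at blocking `Lc^n`. -/
theorem e3Of_eq_e3OfS {Lc : ℕ} [NeZero Lc] (cE cVH cΛ : ℝ) (n : ℕ) :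
    e3Of d Lc cE cVH cΛ n = e3OfS (Lc ^ n) (Sc d Lc cE cVH cΛ (n - 1)) := rfl

/-- [folklore] Member `n+1` reads the level-`n` composite family at blocking `Lc^{n+1}` (no truncated subtraction). -/
theorem e3Of_succ_eq_e3OfS {Lc : ℕ} [NeZero Lc] (cE cVH cΛ : ℝ) (n : ℕ) :
    e3Of d Lc cE cVH cΛ (n + 1) = e3OfS (Lc ^ (n + 1)) (Sc d Lc cE cVH cΛ n) := rfl

variable {N : ℕ} [NeZero N]

/-- [folklore] The raw entry formula of the field–field block of `e3OfS` (definition unfolded; tsum nesting as defined). -/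
theorem e3OfS_inl_inl (S : Fin (d + 1) → (Fin (d + 1) → ℤ) → MKer (d + 1) (Fib d)) (κ' : Fin (d + 1))
    (u' x' z' : Fin (d + 1) → ℤ) (α β : Fin (d + 1)) :
    e3OfS N S κ' u' x' z' (Sum.inl α) (Sum.inl β) =
      -∑' y : Fin (d + 1) → ℤ, ∑ g : Fib d,
        (∑' w : Fin (d + 1) → ℤ, ∑ f : Fib d, KInv (N := N) (d := d) ((N : ℤ) • x') w (Sum.inr α) f *
            ∑ κ'' : Fin (d + 1), ∑' u : Fin (d + 1) → ℤ, wH (N := N) κ'' κ' (u - (N : ℤ) • u') * S κ'' u w y f g) *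
          KInv (N := N) (d := d) y ((N : ℤ) • z') g (Sum.inr β) := by
  rfl

/-- [folklore] `e3OfS` has no multiplier legs: it is an `mm`-read (field–field-supported on the coarse lattice). -/
theorem e3OfS_inl_inr (S : Fin (d + 1) → (Fin (d + 1) → ℤ) → MKer (d + 1) (Fib d)) (κ' : Fin (d + 1))
    (u' x' z' : Fin (d + 1) → ℤ) (α ν : Fin (d + 1)) : e3OfS N S κ' u' x' z' (Sum.inl α) (Sum.inr ν) = 0 := by
  simp only [e3OfS, BalabanStepJetsSucc.mmRead_inr_right, neg_zero]

/-- [folklore] `e3OfS` has no multiplier legs (first leg). -/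
theorem e3OfS_inr (S : Fin (d + 1) → (Fin (d + 1) → ℤ) → MKer (d + 1) (Fib d)) (κ' : Fin (d + 1))
    (u' x' z' : Fin (d + 1) → ℤ) (μ : Fin (d + 1)) (b : Fib d) : e3OfS N S κ' u' x' z' (Sum.inr μ) b = 0 := by
  simp only [e3OfS, BalabanStepJetsSucc.mmRead_inr_left, neg_zero]

/-- [folklore] **(PC-1) CHANNEL SPLIT, ff**: for a FIELD–FIELD-supported stencil family only the legs `GamΦ_N` (row) and `wH_N`
(column) of the packed resolvent enter the third jet — the fluctuation covariance `Γ` and the multiplier response `wΦ` never do. -/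
theorem e3OfS_ff (S : Fin (d + 1) → (Fin (d + 1) → ℤ) → MKer (d + 1) (Fib d))
    (hfm : ∀ κ u x z α ν, S κ u x z (Sum.inl α) (Sum.inr ν) = 0) (hm : ∀ κ u x z μ b, S κ u x z (Sum.inr μ) b = 0)
    (κ' : Fin (d + 1)) (u' x' z' : Fin (d + 1) → ℤ) (α β : Fin (d + 1)) :
    e3OfS N S κ' u' x' z' (Sum.inl α) (Sum.inl β) =
      -∑' y : Fin (d + 1) → ℤ, ∑ l' : Fin (d + 1),
        (∑' w : Fin (d + 1) → ℤ, ∑ l : Fin (d + 1), GamΦ (N := N) α x' l w *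
            ∑ κ'' : Fin (d + 1), ∑' u : Fin (d + 1) → ℤ,
              wH (N := N) κ'' κ' (u - (N : ℤ) • u') * S κ'' u w y (Sum.inl l) (Sum.inl l')) *
          wH (N := N) l' β (y - (N : ℤ) • z') := by
  rw [e3OfS_inl_inl]
  simp only [Fintype.sum_sum_type, hfm, hm, mul_zero, tsum_zero, Finset.sum_const_zero, zero_mul, add_zero,
    KInv_inl_inr_coarse, KInv_inr_inl_coarse]

/-- [folklore] **(PC-1) CHANNEL SPLIT, fm**: for a FIELD–MULTIPLIER-supported stencil family the legs are `GamΦ_N` (row) and the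
multiplier–multiplier block of `KInv_N` (column; `= wΦ_N` at the coarse points, `0` off them). -/
theorem e3OfS_fm (S : Fin (d + 1) → (Fin (d + 1) → ℤ) → MKer (d + 1) (Fib d))
    (hff : ∀ κ u x z α β, S κ u x z (Sum.inl α) (Sum.inl β) = 0) (hm : ∀ κ u x z μ b, S κ u x z (Sum.inr μ) b = 0)
    (κ' : Fin (d + 1)) (u' x' z' : Fin (d + 1) → ℤ) (α β : Fin (d + 1)) :
    e3OfS N S κ' u' x' z' (Sum.inl α) (Sum.inl β) =
      -∑' y : Fin (d + 1) → ℤ, ∑ l' : Fin (d + 1),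
        (∑' w : Fin (d + 1) → ℤ, ∑ l : Fin (d + 1), GamΦ (N := N) α x' l w *
            ∑ κ'' : Fin (d + 1), ∑' u : Fin (d + 1) → ℤ,
              wH (N := N) κ'' κ' (u - (N : ℤ) • u') * S κ'' u w y (Sum.inl l) (Sum.inr l')) *
          KInv (N := N) (d := d) y ((N : ℤ) • z') (Sum.inr l') (Sum.inr β) := by
  rw [e3OfS_inl_inl]
  simp only [Fintype.sum_sum_type, hff, hm, mul_zero, tsum_zero, Finset.sum_const_zero, zero_mul, zero_add, add_zero,
    KInv_inr_inl_coarse]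

/-- [folklore] **(PC-1) CHANNEL SPLIT, mf**: for a MULTIPLIER–FIELD-supported stencil family the legs are the multiplier–multiplier
block of `KInv_N` (row) and `wH_N` (column). -/
theorem e3OfS_mf (S : Fin (d + 1) → (Fin (d + 1) → ℤ) → MKer (d + 1) (Fib d))
    (hl : ∀ κ u x z α b, S κ u x z (Sum.inl α) b = 0) (hmm : ∀ κ u x z μ ν, S κ u x z (Sum.inr μ) (Sum.inr ν) = 0)
    (κ' : Fin (d + 1)) (u' x' z' : Fin (d + 1) → ℤ) (α β : Fin (d + 1)) :
    e3OfS N S κ' u' x' z' (Sum.inl α) (Sum.inl β) =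
      -∑' y : Fin (d + 1) → ℤ, ∑ l' : Fin (d + 1),
        (∑' w : Fin (d + 1) → ℤ, ∑ l : Fin (d + 1), KInv (N := N) (d := d) ((N : ℤ) • x') w (Sum.inr α) (Sum.inr l) *
            ∑ κ'' : Fin (d + 1), ∑' u : Fin (d + 1) → ℤ,
              wH (N := N) κ'' κ' (u - (N : ℤ) • u') * S κ'' u w y (Sum.inr l) (Sum.inl l')) *
          wH (N := N) l' β (y - (N : ℤ) • z') := by
  rw [e3OfS_inl_inl]
  simp only [Fintype.sum_sum_type, hl, hmm, mul_zero, tsum_zero, Finset.sum_const_zero, zero_mul, zero_add, add_zero,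
    KInv_inl_inr_coarse]

/-- [folklore] **(PC-1) CHANNEL SPLIT, off-diagonal**: for an (fm ⊕ mf)-supported stencil family (no ff, no mm block — every
(V-H) piece of `Sc`) the third jet is the sum, INSIDE the outer tsum, of the mf channel (row leg = the multiplier–multiplier block of
`KInv_N`, column leg `wH_N`) and the fm channel (row `GamΦ_N`, column = the multiplier–multiplier block of `KInv_N`). -/
theorem e3OfS_offdiag (S : Fin (d + 1) → (Fin (d + 1) → ℤ) → MKer (d + 1) (Fib d))
    (hff : ∀ κ u x z α β, S κ u x z (Sum.inl α) (Sum.inl β) = 0) (hmm : ∀ κ u x z μ ν, S κ u x z (Sum.inr μ) (Sum.inr ν) = 0)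
    (κ' : Fin (d + 1)) (u' x' z' : Fin (d + 1) → ℤ) (α β : Fin (d + 1)) :
    e3OfS N S κ' u' x' z' (Sum.inl α) (Sum.inl β) =
      -∑' y : Fin (d + 1) → ℤ,
        ((∑ l' : Fin (d + 1),
          (∑' w : Fin (d + 1) → ℤ, ∑ l : Fin (d + 1), KInv (N := N) (d := d) ((N : ℤ) • x') w (Sum.inr α) (Sum.inr l) *
              ∑ κ'' : Fin (d + 1), ∑' u : Fin (d + 1) → ℤ,
                wH (N := N) κ'' κ' (u - (N : ℤ) • u') * S κ'' u w y (Sum.inr l) (Sum.inl l')) *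
            wH (N := N) l' β (y - (N : ℤ) • z')) +
        ∑ l' : Fin (d + 1),
          (∑' w : Fin (d + 1) → ℤ, ∑ l : Fin (d + 1), GamΦ (N := N) α x' l w *
              ∑ κ'' : Fin (d + 1), ∑' u : Fin (d + 1) → ℤ,
                wH (N := N) κ'' κ' (u - (N : ℤ) • u') * S κ'' u w y (Sum.inl l) (Sum.inr l')) *
            KInv (N := N) (d := d) y ((N : ℤ) • z') (Sum.inr l') (Sum.inr β)) := by
  rw [e3OfS_inl_inl]
  simp only [Fintype.sum_sum_type, hff, hmm, mul_zero, tsum_zero, Finset.sum_const_zero, zero_add, add_zero,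
    KInv_inr_inl_coarse, KInv_inl_inr_coarse]


/-! ## §2 Scalar pull-through (the only «analysis»: `tsum_mul_left`, unconditional over `ℝ`) -/

section Pull

variable (G : Fin (d + 1) → (Fin (d + 1) → ℤ) → ℝ) (H : Fin (d + 1) → (Fin (d + 1) → ℤ) → ℝ)
  (T : Fin (d + 1) → (Fin (d + 1) → ℤ) → (Fin (d + 1) → ℤ) → (Fin (d + 1) → ℤ) → Fin (d + 1) → Fin (d + 1) → ℝ)
  (K : Fin (d + 1) → (Fin (d + 1) → ℤ) → ℝ)

/-- [folklore] A scalar on the stencil factors out of the sandwich (tsum nesting untouched). -/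
theorem pull_inner (e : ℝ) :
    (∑' y : Fin (d + 1) → ℤ, ∑ l' : Fin (d + 1),
        (∑' w : Fin (d + 1) → ℤ, ∑ l : Fin (d + 1), G l w *
            ∑ κ'' : Fin (d + 1), ∑' u : Fin (d + 1) → ℤ, H κ'' u * (e * T κ'' u w y l l')) * K l' y) =
      e * ∑' y : Fin (d + 1) → ℤ, ∑ l' : Fin (d + 1),
        (∑' w : Fin (d + 1) → ℤ, ∑ l : Fin (d + 1), G l w *
            ∑ κ'' : Fin (d + 1), ∑' u : Fin (d + 1) → ℤ, H κ'' u * T κ'' u w y l l') * K l' y := by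
  have hu : ∀ κ'' w y l l', (∑' u : Fin (d + 1) → ℤ, H κ'' u * (e * T κ'' u w y l l')) =
      e * ∑' u : Fin (d + 1) → ℤ, H κ'' u * T κ'' u w y l l' := fun κ'' w y l l' => by
    rw [← tsum_mul_left]; exact tsum_congr fun u => by ring
  have hk : ∀ w y l l', (∑ κ'' : Fin (d + 1), ∑' u : Fin (d + 1) → ℤ, H κ'' u * (e * T κ'' u w y l l')) =
      e * ∑ κ'' : Fin (d + 1), ∑' u : Fin (d + 1) → ℤ, H κ'' u * T κ'' u w y l l' := fun w y l l' => by
    simp_rw [hu]; rw [Finset.mul_sum]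
  have hl : ∀ w y l', (∑ l : Fin (d + 1), G l w * ∑ κ'' : Fin (d + 1), ∑' u : Fin (d + 1) → ℤ, H κ'' u * (e * T κ'' u w y l l')) =
      e * ∑ l : Fin (d + 1), G l w * ∑ κ'' : Fin (d + 1), ∑' u : Fin (d + 1) → ℤ, H κ'' u * T κ'' u w y l l' := fun w y l' => by
    simp_rw [hk]; rw [Finset.mul_sum]; exact Finset.sum_congr rfl fun _ _ => by ring
  have hw : ∀ y l', (∑' w : Fin (d + 1) → ℤ, ∑ l : Fin (d + 1), G l w *
      ∑ κ'' : Fin (d + 1), ∑' u : Fin (d + 1) → ℤ, H κ'' u * (e * T κ'' u w y l l')) =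
      e * ∑' w : Fin (d + 1) → ℤ, ∑ l : Fin (d + 1), G l w *
        ∑ κ'' : Fin (d + 1), ∑' u : Fin (d + 1) → ℤ, H κ'' u * T κ'' u w y l l' := fun y l' => by
    simp_rw [hl]; exact tsum_mul_left
  have hy : ∀ y, (∑ l' : Fin (d + 1), (∑' w : Fin (d + 1) → ℤ, ∑ l : Fin (d + 1), G l w *
      ∑ κ'' : Fin (d + 1), ∑' u : Fin (d + 1) → ℤ, H κ'' u * (e * T κ'' u w y l l')) * K l' y) =
      e * ∑ l' : Fin (d + 1), (∑' w : Fin (d + 1) → ℤ, ∑ l : Fin (d + 1), G l w *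
        ∑ κ'' : Fin (d + 1), ∑' u : Fin (d + 1) → ℤ, H κ'' u * T κ'' u w y l l') * K l' y := fun y => by
    simp_rw [hw]; rw [Finset.mul_sum]; exact Finset.sum_congr rfl fun _ _ => by ring
  simp_rw [hy]; exact tsum_mul_left

/-- [folklore] Scalars on the three legs and on the vertex-location sum factor out of the sandwich (tsum nesting untouched). -/
theorem pull_legs (a b c g : ℝ) :
    (∑' y : Fin (d + 1) → ℤ, ∑ l' : Fin (d + 1),
        (∑' w : Fin (d + 1) → ℤ, ∑ l : Fin (d + 1), (a * G l w) *
            ∑ κ'' : Fin (d + 1), b * ∑' u : Fin (d + 1) → ℤ, (c * H κ'' u) * T κ'' u w y l l') * (g * K l' y)) =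
      (a * b * c * g) * ∑' y : Fin (d + 1) → ℤ, ∑ l' : Fin (d + 1),
        (∑' w : Fin (d + 1) → ℤ, ∑ l : Fin (d + 1), G l w *
            ∑ κ'' : Fin (d + 1), ∑' u : Fin (d + 1) → ℤ, H κ'' u * T κ'' u w y l l') * K l' y := by
  have hu : ∀ κ'' w y l l', (∑' u : Fin (d + 1) → ℤ, (c * H κ'' u) * T κ'' u w y l l') =
      c * ∑' u : Fin (d + 1) → ℤ, H κ'' u * T κ'' u w y l l' := fun κ'' w y l l' => by
    rw [← tsum_mul_left]; exact tsum_congr fun u => by ring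
  have hk : ∀ w y l l', (∑ κ'' : Fin (d + 1), b * ∑' u : Fin (d + 1) → ℤ, (c * H κ'' u) * T κ'' u w y l l') =
      (b * c) * ∑ κ'' : Fin (d + 1), ∑' u : Fin (d + 1) → ℤ, H κ'' u * T κ'' u w y l l' := fun w y l l' => by
    simp_rw [hu]; rw [Finset.mul_sum]; exact Finset.sum_congr rfl fun _ _ => by ring
  have hl : ∀ w y l', (∑ l : Fin (d + 1), (a * G l w) *
      ∑ κ'' : Fin (d + 1), b * ∑' u : Fin (d + 1) → ℤ, (c * H κ'' u) * T κ'' u w y l l') =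
      (a * b * c) * ∑ l : Fin (d + 1), G l w * ∑ κ'' : Fin (d + 1), ∑' u : Fin (d + 1) → ℤ, H κ'' u * T κ'' u w y l l' :=
    fun w y l' => by
    simp_rw [hk]; rw [Finset.mul_sum]; exact Finset.sum_congr rfl fun _ _ => by ring
  have hw : ∀ y l', (∑' w : Fin (d + 1) → ℤ, ∑ l : Fin (d + 1), (a * G l w) *
      ∑ κ'' : Fin (d + 1), b * ∑' u : Fin (d + 1) → ℤ, (c * H κ'' u) * T κ'' u w y l l') =
      (a * b * c) * ∑' w : Fin (d + 1) → ℤ, ∑ l : Fin (d + 1), G l w *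
        ∑ κ'' : Fin (d + 1), ∑' u : Fin (d + 1) → ℤ, H κ'' u * T κ'' u w y l l' := fun y l' => by
    simp_rw [hl]; exact tsum_mul_left
  have hy : ∀ y, (∑ l' : Fin (d + 1), (∑' w : Fin (d + 1) → ℤ, ∑ l : Fin (d + 1), (a * G l w) *
      ∑ κ'' : Fin (d + 1), b * ∑' u : Fin (d + 1) → ℤ, (c * H κ'' u) * T κ'' u w y l l') * (g * K l' y)) =
      (a * b * c * g) * ∑ l' : Fin (d + 1), (∑' w : Fin (d + 1) → ℤ, ∑ l : Fin (d + 1), G l w *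
        ∑ κ'' : Fin (d + 1), ∑' u : Fin (d + 1) → ℤ, H κ'' u * T κ'' u w y l l') * K l' y := fun y => by
    simp_rw [hw]; rw [Finset.mul_sum]; exact Finset.sum_congr rfl fun _ _ => by ring
  simp_rw [hy]; exact tsum_mul_left

end Pull

section PullTwo

variable (R G : Fin (d + 1) → (Fin (d + 1) → ℤ) → ℝ) (H : Fin (d + 1) → (Fin (d + 1) → ℤ) → ℝ)
  (T₁ T₂ : Fin (d + 1) → (Fin (d + 1) → ℤ) → (Fin (d + 1) → ℤ) → (Fin (d + 1) → ℤ) → Fin (d + 1) → Fin (d + 1) → ℝ)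
  (K₁ K₂ : Fin (d + 1) → (Fin (d + 1) → ℤ) → ℝ)

/-- [folklore] One channel at fixed outer site `y`: all five scalars (row, block average, middle leg, column, stencil) factor out. -/
theorem chan_pull (X : Fin (d + 1) → (Fin (d + 1) → ℤ) → ℝ)
    (T : Fin (d + 1) → (Fin (d + 1) → ℤ) → (Fin (d + 1) → ℤ) → (Fin (d + 1) → ℤ) → Fin (d + 1) → Fin (d + 1) → ℝ)
    (K : Fin (d + 1) → (Fin (d + 1) → ℤ) → ℝ) (p b c q e : ℝ) (y : Fin (d + 1) → ℤ) :
    (∑ l' : Fin (d + 1), (∑' w : Fin (d + 1) → ℤ, ∑ l : Fin (d + 1), (p * X l w) *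
        ∑ κ'' : Fin (d + 1), b * ∑' u : Fin (d + 1) → ℤ, (c * H κ'' u) * (e * T κ'' u w y l l')) * (q * K l' y)) =
      (p * b * c * q * e) * ∑ l' : Fin (d + 1), (∑' w : Fin (d + 1) → ℤ, ∑ l : Fin (d + 1), X l w *
        ∑ κ'' : Fin (d + 1), ∑' u : Fin (d + 1) → ℤ, H κ'' u * T κ'' u w y l l') * K l' y := by
  have hu : ∀ κ'' w l l', (∑' u : Fin (d + 1) → ℤ, (c * H κ'' u) * (e * T κ'' u w y l l')) =
      (c * e) * ∑' u : Fin (d + 1) → ℤ, H κ'' u * T κ'' u w y l l' := fun κ'' w l l' => by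
    rw [← tsum_mul_left]; exact tsum_congr fun u => by ring
  have hk : ∀ w l l', (∑ κ'' : Fin (d + 1), b * ∑' u : Fin (d + 1) → ℤ, (c * H κ'' u) * (e * T κ'' u w y l l')) =
      (b * c * e) * ∑ κ'' : Fin (d + 1), ∑' u : Fin (d + 1) → ℤ, H κ'' u * T κ'' u w y l l' := fun w l l' => by
    simp_rw [hu]; rw [Finset.mul_sum]; exact Finset.sum_congr rfl fun _ _ => by ring
  have hl : ∀ w l', (∑ l : Fin (d + 1), (p * X l w) *
      ∑ κ'' : Fin (d + 1), b * ∑' u : Fin (d + 1) → ℤ, (c * H κ'' u) * (e * T κ'' u w y l l')) =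
      (p * b * c * e) * ∑ l : Fin (d + 1), X l w * ∑ κ'' : Fin (d + 1), ∑' u : Fin (d + 1) → ℤ, H κ'' u * T κ'' u w y l l' :=
    fun w l' => by
    simp_rw [hk]; rw [Finset.mul_sum]; exact Finset.sum_congr rfl fun _ _ => by ring
  have hw : ∀ l', (∑' w : Fin (d + 1) → ℤ, ∑ l : Fin (d + 1), (p * X l w) *
      ∑ κ'' : Fin (d + 1), b * ∑' u : Fin (d + 1) → ℤ, (c * H κ'' u) * (e * T κ'' u w y l l')) =
      (p * b * c * e) * ∑' w : Fin (d + 1) → ℤ, ∑ l : Fin (d + 1), X l w *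
        ∑ κ'' : Fin (d + 1), ∑' u : Fin (d + 1) → ℤ, H κ'' u * T κ'' u w y l l' := fun l' => by
    simp_rw [hl]; exact tsum_mul_left
  simp_rw [hw]; rw [Finset.mul_sum]; exact Finset.sum_congr rfl fun _ _ => by ring

/-- [folklore] A scalar on the stencil factors out of the two-channel (off-diagonal) sandwich. -/
theorem pull_two_inner (e : ℝ) :
    (∑' y : Fin (d + 1) → ℤ,
      ((∑ l' : Fin (d + 1), (∑' w : Fin (d + 1) → ℤ, ∑ l : Fin (d + 1), R l w *
          ∑ κ'' : Fin (d + 1), ∑' u : Fin (d + 1) → ℤ, H κ'' u * (e * T₁ κ'' u w y l l')) * K₁ l' y) +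
        ∑ l' : Fin (d + 1), (∑' w : Fin (d + 1) → ℤ, ∑ l : Fin (d + 1), G l w *
          ∑ κ'' : Fin (d + 1), ∑' u : Fin (d + 1) → ℤ, H κ'' u * (e * T₂ κ'' u w y l l')) * K₂ l' y)) =
      e * ∑' y : Fin (d + 1) → ℤ,
        ((∑ l' : Fin (d + 1), (∑' w : Fin (d + 1) → ℤ, ∑ l : Fin (d + 1), R l w *
            ∑ κ'' : Fin (d + 1), ∑' u : Fin (d + 1) → ℤ, H κ'' u * T₁ κ'' u w y l l') * K₁ l' y) +
          ∑ l' : Fin (d + 1), (∑' w : Fin (d + 1) → ℤ, ∑ l : Fin (d + 1), G l w *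
            ∑ κ'' : Fin (d + 1), ∑' u : Fin (d + 1) → ℤ, H κ'' u * T₂ κ'' u w y l l') * K₂ l' y) := by
  have h1 := fun y => chan_pull H R T₁ K₁ 1 1 1 1 e y
  have h2 := fun y => chan_pull H G T₂ K₂ 1 1 1 1 e y
  simp only [one_mul] at h1 h2
  simp_rw [h1, h2, ← mul_add]; exact tsum_mul_left

/-- [folklore] Scalars on the legs factor out of the two-channel (off-diagonal) sandwich when the two channels carry the same total
unit (`a′·g′ = a·g`: row × column leg units agree — `wΦ`-unit × `wH`-unit both ways). -/
theorem pull_two_legs (a b c g a' g' : ℝ) (hs : a' * g' = a * g) :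
    (∑' y : Fin (d + 1) → ℤ,
      ((∑ l' : Fin (d + 1), (∑' w : Fin (d + 1) → ℤ, ∑ l : Fin (d + 1), (a * R l w) *
          ∑ κ'' : Fin (d + 1), b * ∑' u : Fin (d + 1) → ℤ, (c * H κ'' u) * T₁ κ'' u w y l l') * (g * K₁ l' y)) +
        ∑ l' : Fin (d + 1), (∑' w : Fin (d + 1) → ℤ, ∑ l : Fin (d + 1), (a' * G l w) *
          ∑ κ'' : Fin (d + 1), b * ∑' u : Fin (d + 1) → ℤ, (c * H κ'' u) * T₂ κ'' u w y l l') * (g' * K₂ l' y))) =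
      (a * b * c * g) * ∑' y : Fin (d + 1) → ℤ,
        ((∑ l' : Fin (d + 1), (∑' w : Fin (d + 1) → ℤ, ∑ l : Fin (d + 1), R l w *
            ∑ κ'' : Fin (d + 1), ∑' u : Fin (d + 1) → ℤ, H κ'' u * T₁ κ'' u w y l l') * K₁ l' y) +
          ∑ l' : Fin (d + 1), (∑' w : Fin (d + 1) → ℤ, ∑ l : Fin (d + 1), G l w *
            ∑ κ'' : Fin (d + 1), ∑' u : Fin (d + 1) → ℤ, H κ'' u * T₂ κ'' u w y l l') * K₂ l' y) := by
  have h1 := fun y => chan_pull H R T₁ K₁ a b c g 1 y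
  have h2 := fun y => chan_pull H G T₂ K₂ a' b c g' 1 y
  simp only [one_mul, mul_one] at h1 h2
  have hs' : a' * b * c * g' = a * b * c * g := by
    calc a' * b * c * g' = (a' * g') * (b * c) := by ring
      _ = (a * g) * (b * c) := by rw [hs]
      _ = a * b * c * g := by ring
  rw [hs'] at h2
  simp_rw [h1, h2, ← mul_add]; exact tsum_mul_left

end PullTwo

/-! ## §3 The (PC-1) SPLIT OF RECORD, WILSON CHANNEL -/

section Wilson

variable {Lc : ℕ} [NeZero Lc]

/-- [folklore] `wilsonA` has no (inl, inr) block. -/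
theorem wilsonA_inl_inr (κ : Fin (d + 1)) (u x z : Fin (d + 1) → ℤ) (α ν : Fin (d + 1)) :
    wilsonA d κ u x z (Sum.inl α) (Sum.inr ν) = 0 := rfl

/-- [folklore] `wilsonA` has no multiplier rows. -/
theorem wilsonA_inr (κ : Fin (d + 1)) (u x z : Fin (d + 1) → ℤ) (μ : Fin (d + 1)) (b : Fib d) :
    wilsonA d κ u x z (Sum.inr μ) b = 0 := by
  cases b <;> rfl

/-- [folklore] **THE WILSON CHANNEL OF THE THIRD JET, RAW FORM** (member `n+1`, `N = Lc^{n+1}`; the Wilson part of `Sc … n` is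
`(cE·(Lc^{d+1})^n) • wilsonA` — `PushSumNest.Sc_succ_closed` + `pushSum_inl_inl`): only `GamΦ_N`, `wH_N` (twice) and the table enter. -/
theorem e3W_raw (cE : ℝ) (n : ℕ) (κ' : Fin (d + 1)) (u' x' z' : Fin (d + 1) → ℤ) (α β : Fin (d + 1)) :
    e3OfS (Lc ^ (n + 1)) (fun κ u => (cE * ((Lc : ℝ) ^ (d + 1)) ^ n) • wilsonA d κ u) κ' u' x' z' (Sum.inl α) (Sum.inl β) =
      -(cE * ((Lc : ℝ) ^ (d + 1)) ^ n) * ∑' y : Fin (d + 1) → ℤ, ∑ l' : Fin (d + 1),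
        (∑' w : Fin (d + 1) → ℤ, ∑ l : Fin (d + 1), GamΦ (N := Lc ^ (n + 1)) α x' l w *
            ∑ κ'' : Fin (d + 1), ∑' u : Fin (d + 1) → ℤ,
              wH (N := Lc ^ (n + 1)) κ'' κ' (u - ((Lc ^ (n + 1) : ℕ) : ℤ) • u') * wilsonA d κ'' u w y (Sum.inl l) (Sum.inl l')) *
          wH (N := Lc ^ (n + 1)) l' β (y - ((Lc ^ (n + 1) : ℕ) : ℤ) • z') := by
  rw [e3OfS_ff _ (fun κ u x z α' ν => by simp only [Pi.smul_apply, smul_eq_mul, wilsonA_inl_inr, mul_zero])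
    (fun κ u x z μ b => by simp only [Pi.smul_apply, smul_eq_mul, wilsonA_inr, mul_zero])]
  simp only [Pi.smul_apply, smul_eq_mul]
  rw [pull_inner, neg_mul]

/-- [folklore] **THE EXPONENT IDENTITY OF THE WILSON CHANNEL** (`N = Lc^{n+1}` as a real number):
`N^{2(d+1)} · cE·(Lc^{d+1})^n = (cE / Lc^{d+1}) · N^{d−3} · [N^{d+2} · N^{−(d+1)} · N^{d+2} · N · N^{d+2}]` — normalisation × Sc's own
factor = (colour weight ∕ one step) × RESIDUAL × (three leg units, one block average, one curl unit). -/
theorem e3W_residual (cE : ℝ) (n : ℕ) :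
    ((Lc : ℝ) ^ (n + 1)) ^ (2 * (d + 1)) * (cE * ((Lc : ℝ) ^ (d + 1)) ^ n) =
      cE / (Lc : ℝ) ^ (d + 1) * ((Lc : ℝ) ^ (n + 1)) ^ ((d : ℤ) - 3) *
        (((Lc : ℝ) ^ (n + 1)) ^ (d + 2) * (((Lc : ℝ) ^ (n + 1)) ^ (d + 1))⁻¹ * ((Lc : ℝ) ^ (n + 1)) ^ (d + 2) *
          (Lc : ℝ) ^ (n + 1) * ((Lc : ℝ) ^ (n + 1)) ^ (d + 2)) := by
  have hL : (Lc : ℝ) ≠ 0 := by exact_mod_cast NeZero.ne Lc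
  have hN : ((Lc : ℝ) ^ (n + 1)) ≠ 0 := pow_ne_zero _ hL
  have hz : ((Lc : ℝ) ^ (n + 1)) ^ ((d : ℤ) - 3) = ((Lc : ℝ) ^ (n + 1)) ^ d / ((Lc : ℝ) ^ (n + 1)) ^ 3 := by
    rw [zpow_sub₀ hN, zpow_natCast, zpow_ofNat]
  rw [hz]
  field_simp
  ring

/-- [folklore] The last step of `e3W_unit_split`: regrouping scalars around the common sandwich `T`. -/
theorem scalar_final {N2 C D Z a b c g e T : ℝ} (h : N2 * C = D * Z * (a * b * c * e * g)) :
    N2 * (-C * T) = -D * Z * (a * b * c * g * (e * T)) := by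
  calc N2 * (-C * T) = -(N2 * C) * T := by ring
    _ = -(D * Z * (a * b * c * e * g)) * T := by rw [h]
    _ = -D * Z * (a * b * c * g * (e * T)) := by ring

/-- [folklore] **`e3W_unit_split` — THE (PC-1) SPLIT OF RECORD, WILSON CHANNEL** (gan24-p1-g3 RULINGS-2, verbatim shape; member
`n+1`, `N = Lc^{n+1}`, `d` generic).  With the THREE LEGS normalised as `H̃_N := N^{d+2}·wH_N`, `G̃_N := N^{d+2}·GamΦ_N`, the vertex-location
sum written as a BLOCK AVERAGE `N^{−(d+1)} Σ'_u`, ONE explicit factor `N` on `wilsonA` (to be cashed against its lattice curl), and Sc's own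
factor `(Lc^{d+1})^n` on the Wilson table:
`N^{2(d+1)} · e3OfS N ((cE·(Lc^{d+1})^n) • wilsonA) = −(cE / Lc^{d+1}) · N^{d−3} · Σ'_y Σ_{l′} (Σ'_w Σ_l G̃(x′;l,w) · Σ_{κ″} N^{−(d+1)} Σ'_u H̃(u − N•u′)_{κ″κ′} · (N·wilsonA κ″ u w y l l′)) · H̃(y − N•z′)_{l′β}`
— residual **`N^{d−3}`**, `= 1` exactly at `d = 3`.  Pure bookkeeping: no estimate, no reordering of sums. -/
theorem e3W_unit_split (cE : ℝ) (n : ℕ) (κ' : Fin (d + 1)) (u' x' z' : Fin (d + 1) → ℤ) (α β : Fin (d + 1)) :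
    ((Lc : ℝ) ^ (n + 1)) ^ (2 * (d + 1)) *
        e3OfS (Lc ^ (n + 1)) (fun κ u => (cE * ((Lc : ℝ) ^ (d + 1)) ^ n) • wilsonA d κ u) κ' u' x' z' (Sum.inl α) (Sum.inl β) =
      -(cE / (Lc : ℝ) ^ (d + 1)) * ((Lc : ℝ) ^ (n + 1)) ^ ((d : ℤ) - 3) *
        ∑' y : Fin (d + 1) → ℤ, ∑ l' : Fin (d + 1),
          (∑' w : Fin (d + 1) → ℤ, ∑ l : Fin (d + 1), (((Lc : ℝ) ^ (n + 1)) ^ (d + 2) * GamΦ (N := Lc ^ (n + 1)) α x' l w) *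
              ∑ κ'' : Fin (d + 1), (((Lc : ℝ) ^ (n + 1)) ^ (d + 1))⁻¹ * ∑' u : Fin (d + 1) → ℤ,
                (((Lc : ℝ) ^ (n + 1)) ^ (d + 2) * wH (N := Lc ^ (n + 1)) κ'' κ' (u - ((Lc ^ (n + 1) : ℕ) : ℤ) • u')) *
                  ((Lc : ℝ) ^ (n + 1) * wilsonA d κ'' u w y (Sum.inl l) (Sum.inl l'))) *
            (((Lc : ℝ) ^ (n + 1)) ^ (d + 2) * wH (N := Lc ^ (n + 1)) l' β (y - ((Lc ^ (n + 1) : ℕ) : ℤ) • z')) := by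
  rw [e3W_raw, pull_legs, pull_inner]
  exact scalar_final (e3W_residual (d := d) cE n)

end Wilson

end Summit.QuantumFields.BalabanUV.Beta.GAN24.E3UnitSplit
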